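import Mathlib.Analysis.InnerProductSpace.PiL2
import Mathlib.Analysis.InnerProductSpace.Projection.FiniteDimensional
import Mathlib.Analysis.InnerProductSpace.Orthonormal
import Literature.Computability.Cryptography.QuantumCircuitProofs
import Literature.Computability.QuantumComplexity.GaussianRank

/-!
# Crux `SpinorFlattening.NegApproxGaussRankSuperpoly` (stmt-QuantumAdvantage-1245) — stub `stub_massBound`

Line `spectral-mass-flattening`, stub `stub_massBound` (BESSEL TAIL FOR A UNITARY FAMILY): if the
matrices `U i` (`i : ι`, a finite family) are unitary, the vectors `U i *ᵥ ψ` are orthonormal for the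
standard Hermitian form `star u ⬝ᵥ v` on `QReg n → ℂ`, and every `U i *ᵥ φ` lies in one subspace `W`,
then
  `|ι| − dim W ≤ |ι| · ‖ψ − φ‖²`   (`‖·‖² = normSq`).

Proof (pure finite-dimensional Hilbert-space algebra, transported to `EuclideanSpace ℂ (QReg n)`):
with `uᵢ := U i ψ` (orthonormal), `vᵢ := U i φ ∈ W` and `P` the orthogonal projection onto `W`,
* `‖uᵢ − vᵢ‖² = ‖U i (ψ − φ)‖² = ‖ψ − φ‖²` (unitaries preserve the norm);
* `‖uᵢ − vᵢ‖² ≥ ‖uᵢ‖² − ‖P uᵢ‖² = 1 − ‖P uᵢ‖²` (Pythagoras: `uᵢ − vᵢ = (uᵢ − P uᵢ) + (P uᵢ − vᵢ)`,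
  the summands being orthogonal);
* `Σᵢ ‖P uᵢ‖² = Σᵢ Σₖ |⟪wₖ, uᵢ⟫|² = Σₖ Σᵢ |⟪uᵢ, wₖ⟫|² ≤ Σₖ ‖wₖ‖² = dim W` for an orthonormal basis
  `(wₖ)` of `W` (Parseval in `W`, then BESSEL's inequality for the orthonormal family `(uᵢ)`).
Summing the second bullet over `i` gives `|ι| − dim W ≤ Σᵢ ‖uᵢ − vᵢ‖² = |ι| · ‖ψ − φ‖²`.
-/

noncomputable section

namespace Summit.QuantumAdvantage.QuantumAdvantage.Theorems.SpinorFlattening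

open Matrix Finset
open Literature.Computability.QuantumComplexity Literature.Computability.Cryptography

/-- The squared Euclidean norm of `toLp 2 x : EuclideanSpace ℂ (QReg n)` is `normSq x = ∑ ‖x y‖²`. -/
theorem massBound_norm_sq_toLp {n : ℕ} (x : QReg n → ℂ) :
    ‖(WithLp.toLp 2 x : EuclideanSpace ℂ (QReg n))‖ ^ 2 = normSq x := by
  rw [EuclideanSpace.norm_sq_eq]
  rfl

/-- Pythagoras below a subspace: for `v ∈ K` and `P` the orthogonal projection onto `K`,
`‖u‖² − ‖P u‖² ≤ ‖u − v‖²` (indeed `‖u − v‖² = ‖u − P u‖² + ‖P u − v‖²` and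
`‖u‖² = ‖P u‖² + ‖u − P u‖²`). -/
theorem massBound_norm_sq_sub_proj_le {E : Type*} [NormedAddCommGroup E] [InnerProductSpace ℂ E]
    (K : Submodule ℂ E) [K.HasOrthogonalProjection] (u v : E) (hv : v ∈ K) :
    ‖u‖ ^ 2 - ‖K.starProjection u‖ ^ 2 ≤ ‖u - v‖ ^ 2 := by
  have h1 : inner ℂ (u - K.starProjection u) (K.starProjection u - v) = 0 :=
    K.starProjection_inner_eq_zero u _ (K.sub_mem (K.starProjection_apply_mem u) hv)
  have h2 : inner ℂ (K.starProjection u) (u - K.starProjection u) = 0 := by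
    rw [inner_eq_zero_symm]
    exact K.starProjection_inner_eq_zero u _ (K.starProjection_apply_mem u)
  have p1 := norm_add_sq_eq_norm_sq_add_norm_sq_of_inner_eq_zero _ _ h1
  have p2 := norm_add_sq_eq_norm_sq_add_norm_sq_of_inner_eq_zero _ _ h2
  rw [sub_add_sub_cancel] at p1
  rw [add_sub_cancel] at p2
  nlinarith [mul_self_nonneg ‖K.starProjection u - v‖, p1, p2]

/-- BESSEL MASS BOUND: for an orthonormal family `(u i)_{i ∈ ι}` and a finite-dimensional subspace `K`
with orthogonal projection `P`, `Σᵢ ‖P uᵢ‖² ≤ dim K` (Parseval in `K` for an orthonormal basis `(wₖ)`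
of `K`, swap the sums, Bessel `Σᵢ |⟪uᵢ, wₖ⟫|² ≤ ‖wₖ‖² = 1`). -/
theorem massBound_sum_norm_sq_proj_le {E : Type*} [NormedAddCommGroup E] [InnerProductSpace ℂ E]
    {ι : Type*} [Fintype ι] (K : Submodule ℂ E) [FiniteDimensional ℂ K] {u : ι → E}
    (hu : Orthonormal ℂ u) :
    ∑ i, ‖K.starProjection (u i)‖ ^ 2 ≤ Module.finrank ℂ K := by
  let b := stdOrthonormalBasis ℂ K
  have hP : ∀ x : E, ‖K.starProjection x‖ ^ 2 = ∑ k, ‖inner ℂ ((b k : K) : E) x‖ ^ 2 := by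
    intro x
    rw [Submodule.starProjection_apply, Submodule.norm_coe, ← b.sum_sq_norm_inner_right]
    simp_rw [Submodule.inner_orthogonalProjectionOnto_eq_of_mem_left]
  calc ∑ i, ‖K.starProjection (u i)‖ ^ 2
      = ∑ i, ∑ k, ‖inner ℂ ((b k : K) : E) (u i)‖ ^ 2 := by simp_rw [hP]
    _ = ∑ k, ∑ i, ‖inner ℂ (u i) ((b k : K) : E)‖ ^ 2 := by
        rw [Finset.sum_comm]
        simp_rw [norm_inner_symm]
    _ ≤ ∑ k, ‖((b k : K) : E)‖ ^ 2 := Finset.sum_le_sum fun k _ => hu.sum_inner_products_le _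
    _ = Module.finrank ℂ K := by
        simp_rw [Submodule.norm_coe, b.norm_eq_one, one_pow, Finset.sum_const, Finset.card_univ,
          Fintype.card_fin, nsmul_eq_mul, mul_one]

/-- **stub_massBound** — BESSEL TAIL FOR A UNITARY FAMILY: if the `U_i` are unitary, the vectors `U_i ψ`
are orthonormal and every `U_i φ` lies in a subspace `W`, then `|ι| − dim W ≤ |ι| · ‖ψ − φ‖²`
(transport to `EuclideanSpace ℂ (QReg n)`; `‖U_i ψ − U_i φ‖² = ‖ψ − φ‖²` by unitarity;
`‖u − v‖² ≥ 1 − ‖P u‖²` for `v ∈ W` by Pythagoras; `Σᵢ ‖P uᵢ‖² ≤ dim W` by Bessel). -/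
theorem stub_massBound :
    ∀ (n : ℕ) (ι : Type) [Fintype ι] (U : ι → Matrix (QReg n) (QReg n) ℂ) (ψ φ : QReg n → ℂ)
      (W : Submodule ℂ (QReg n → ℂ)),
      (∀ i, U i ∈ Matrix.unitaryGroup (QReg n) ℂ) →
      (∀ i, star (U i *ᵥ ψ) ⬝ᵥ (U i *ᵥ ψ) = 1) →
      (∀ i j, i ≠ j → star (U i *ᵥ ψ) ⬝ᵥ (U j *ᵥ ψ) = 0) →
      (∀ i, U i *ᵥ φ ∈ W) →
        (Fintype.card ι : ℝ) - Module.finrank ℂ W ≤ Fintype.card ι * normSq (ψ - φ) := by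
  intro n ι _ U ψ φ W hU hnorm horth hW
  classical
  -- transport to the Euclidean space `ℂ^{QReg n}`
  let e : (QReg n → ℂ) ≃ₗ[ℂ] EuclideanSpace ℂ (QReg n) := (WithLp.linearEquiv 2 ℂ (QReg n → ℂ)).symm
  let u : ι → EuclideanSpace ℂ (QReg n) := fun i => WithLp.toLp 2 (U i *ᵥ ψ)
  let W' : Submodule ℂ (EuclideanSpace ℂ (QReg n)) :=
    W.map (e : (QReg n → ℂ) →ₗ[ℂ] EuclideanSpace ℂ (QReg n))
  have hfin : Module.finrank ℂ W' = Module.finrank ℂ W := LinearEquiv.finrank_map_eq e W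
  -- the family `u` is orthonormal
  have hu : Orthonormal ℂ u := by
    rw [orthonormal_iff_ite]
    intro i j
    change inner ℂ (WithLp.toLp 2 (U i *ᵥ ψ)) (WithLp.toLp 2 (U j *ᵥ ψ)) = _
    rw [EuclideanSpace.inner_toLp_toLp, dotProduct_comm]
    split_ifs with h
    · subst h
      exact hnorm i
    · exact horth i j h
  -- per-index bound `1 − ‖P uᵢ‖² ≤ ‖ψ − φ‖²`
  have key : ∀ i, 1 - ‖W'.starProjection (u i)‖ ^ 2 ≤ normSq (ψ - φ) := by
    intro i
    have hv : (WithLp.toLp 2 (U i *ᵥ φ) : EuclideanSpace ℂ (QReg n)) ∈ W' :=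
      Submodule.mem_map_of_mem (hW i)
    have h := massBound_norm_sq_sub_proj_le W' (u i) _ hv
    rw [hu.norm_eq_one i, one_pow] at h
    refine h.trans_eq ?_
    change ‖WithLp.toLp 2 (U i *ᵥ ψ) - WithLp.toLp 2 (U i *ᵥ φ)‖ ^ 2 = _
    rw [← WithLp.toLp_sub, ← Matrix.mulVec_sub, massBound_norm_sq_toLp,
      normSq_mulVec_of_mem_unitaryGroup (hU i)]
  -- Bessel: `Σᵢ ‖P uᵢ‖² ≤ dim W`
  have bessel : ∑ i, ‖W'.starProjection (u i)‖ ^ 2 ≤ Module.finrank ℂ W' :=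
    massBound_sum_norm_sq_proj_le W' hu
  -- sum the per-index bounds
  have hsum : ∑ i, (1 - ‖W'.starProjection (u i)‖ ^ 2) ≤ ∑ _i : ι, normSq (ψ - φ) :=
    Finset.sum_le_sum fun i _ => key i
  rw [Finset.sum_sub_distrib, Finset.sum_const, Finset.sum_const, Finset.card_univ, nsmul_eq_mul,
    nsmul_eq_mul, mul_one] at hsum
  have hfin' : (Module.finrank ℂ W' : ℝ) = Module.finrank ℂ W := by exact_mod_cast hfin
  linarith
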